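import Literature.MathematicalPhysics.QuantumFieldTheory.Balaban1983to89.B13NodeTorusTermwise
import Literature.MathematicalPhysics.QuantumFieldTheory.Balaban1983to89.B13NodeTorusFamily

/-!
# `Balaban1983to89.B13NodeTorusFamilyLocated` — [Balaban1988RG2Cluster] CMP **116** (1988) 1–22, Lemmas 1–3 pp. 9, 11, 20 along a RUN,
# FROM LOCATED INPUTS ONLY: the history-indexed B13 family `∀ k v, v ∈ FlowStep.Box γ₀ k → Lemma1Printed ∧ Lemma2Printed ∧ Lemma3Printed`
# for two-scale torus step data `(Wt k v).toStepData` with NO leaf conjunct entering as typed — Lemmas 1–2 per member from the per-member located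
# inputs of `B13NodeTorusTermwise.lemma12_twoTorus` at constants that see NEITHER the step `k` NOR the history `v` (answering dag-ref-B READ #91
# D1: «k-uniformity PROVED for Lemma 3 and ASSUMED for Lemmas 1–2»), Lemma 3 by the family socket `B13NodeTorusFamily.bound238_family`

statement-level bookkeeping over published theorems with citation tags; kernel-checked compositions of tree theorems;
nothing here is a claim about the Yang–Mills mass gap.

CITATION HEADER (lean-in-tree rule).  Source: T. Bałaban, *Renormalization group approach to lattice gauge field theories. II. Cluster
expansions*, Commun. Math. Phys. **116**, 1–22 (1988), doi:10.1007/bf01239022 [Balaban1988RG2Cluster].  p. 9 Lemma 1: *"There exist absolute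
constants C₁, C₂, q, for which |V′_k(Y, 𝐔, 𝐉, B)| ≦ E₀ε₁C₁M^q exp C₂κ₁ exp(−(1 − 2δ)κd_k(Y)). (1.36)"*; p. 11 Lemma 2: *"|Q(Y, B, b, b′)| ≦ C₃ε₁M⁴
exp C₂κ₁ exp(−⅛(κ₁ − 1)d_k(Y) − ½(κ₁ − 1)M⁻⁴|Y|), (1.43) and the function V″_k(Y, B) satisfies the bound (1.36)"*; p. 10: *"(1/g_k²)V(g_kB′)"*, the
space (1.34) *"{B : |B| < ε₁g_k⁻¹ on Y}"*; p. 20 Lemma 3 (2.38).  [Balaban1987RG1] Thm 1 p. 259: *"0 < g_k ≦ γ"*.  Seat `pub-ymgap-dag-p2` = n10-a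
(YM-PLAN Track A, HUMAN RULING D-0062), generation g4, module 4.  BY NAME and UNCHANGED: `…B13NodeTorusTermwise` (this seat g3, p411918:
`lemma12_twoTorus` — Lemma 1 ∧ Lemma 2 for ONE two-scale torus step from located inputs), `…B13NodeTorusFamily` (g4 module 2, p413625:
`lemma3Printed_family`, `last_pos_of_mem_box`), `…B13Lemma3TorusSocket` (`TermDomination`, `Termwise226`, `Lemma3Numerics`), `…FlowStep` (`Box`).

WHAT THIS FILE PROVES (0 `sorry`, 0 `def`, standard axioms).
§1 **`lemma12_family`** — LEMMA 1 ∧ LEMMA 2 FOR EVERY MEMBER `(k, v)`, `v ∈ ]0, γ₀]^{k+1}`, of a history-indexed family of two-scale torus steps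
   `Wt k v : TwoTorusStep 4 L (N′ k v)` from PER-MEMBER located inputs — (1.33)'s index data, per-term analyticity, per-term (1.24)∕(1.30), the
   local pieces of P^{(k)}, the coordinate reading of B, the per-cube scaled cubic `1/g_k²`-terms with the (1.38)∕(1.39) data, the identifications
   `hV`∕`hQ`, (1.34) in coordinates, `volk = #Y`, per-term analyticity, gauge invariance by assertion — each indexed by `(k, v)` and asked only
   on the box, with Lemma 2's coupling letter READ OFF THE HISTORY: `g = g_k := v (Fin.last k)` (≠ 0 on the box, `last_pos_of_mem_box`), and with
   EVERY CONSTANT UNIFORM: one `c`, one pair `K, K′` of (1.24)∕(1.30) prefactors, one headroom `θ`, one choice `hC` of C₁, C₂, q, one Cauchy radius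
   `R` and cubic constant `K₂`, one multiplicity `m₂`, one floor, one set of thresholds.  Proof: `fun k v hv => lemma12_twoTorus (Wt k v) c k …`.
§2 **`b13Family_located`** — the (R1) family triple `∀ k v, v ∈ Box γ₀ k → Lemma1Printed ∧ Lemma2Printed ∧ Lemma3Printed` for `(Wt k v).toStepData`
   from §1's inputs and the Lemma-3 inputs of `B13NodeTorusFamily.bound238_family` (per-member termwise domination + (2.26) per term at the natural
   rate `γ₂ε₁²/g_k²`, ONE numerics bundle at the box minimum) — NO leaf conjunct as hypothesis; **`b13Family_located_stepData`** — the same for a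
   step-data family `S13 k v` pinned to the torus records on the box (the dagwriter's `b13` family predicate, word (R1) bus l.9758).

HONEST FRAMING.  Count-neutral typing∕bookkeeping: the k- and history-UNIFORMITY of the constants of the typed Lemmas 1–3 on the torus is now
a kernel statement for all three lemmas (Lemmas 1–2: this file; Lemma 3: module 2), CONDITIONAL on per-member located inputs whose own k-uniformity is the
substantive open-in-print item (the per-term (1.24)∕(1.30) prefactors `K, K′` and the (1.38) data `K₂` uniform in k come from [13]'s propagator
bounds uniformly in k — cell GAPS G-B9-10 — and [15] Prop. 4; the NODE-O∕A kernel letters behind (2.26) likewise); N10 NOT discharged; Bałaban AS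
PRINTED with locators; one finite T⁴ programme at fixed ε per run — NOT continuum ∕ ℝ⁴ ∕ OS ∕ mass gap ∕ Clay.  No `sorry`, no definition.
-/

set_option maxSynthPendingDepth 3

noncomputable section

namespace Literature.MathematicalPhysics.QuantumFieldTheory.Balaban1983to89.B13NodeTorusFamilyLocated

open Metric
open Literature.MathematicalPhysics.QuantumFieldTheory.Balaban1983to89
open Literature.MathematicalPhysics.QuantumFieldTheory.Balaban1983to89.B13ScaleTransfer (Pt)
open Literature.MathematicalPhysics.QuantumFieldTheory.Balaban1983to89.B16Absorption (pbox)
open Literature.MathematicalPhysics.QuantumFieldTheory.Balaban1983to89.TreeLengthTorus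
open Literature.MathematicalPhysics.QuantumFieldTheory.Balaban1983to89.TreeLengthTorusGeometry
open Literature.MathematicalPhysics.QuantumFieldTheory.Balaban1983to89.TreeLengthTorusTransfer (tcoarse)
open Literature.MathematicalPhysics.QuantumFieldTheory.Balaban1983to89.B12TreeDecay (kappa₀ K₀)
open Literature.MathematicalPhysics.QuantumFieldTheory.Balaban1983to89.B13Lemma3TorusData
open Literature.MathematicalPhysics.QuantumFieldTheory.Balaban1983to89.B13Lemma3Torus (TwoTorusStep)
open Literature.MathematicalPhysics.QuantumFieldTheory.Balaban1983to89.B13Lemma3TorusSocket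
  (TermDomination Termwise226 Lemma3Numerics)
open Literature.MathematicalPhysics.QuantumFieldTheory.Balaban1983to89.B13PkScaling (Qop scaled)
open Literature.MathematicalPhysics.QuantumFieldTheory.Balaban1983to89.B13NodeTorusTermwise (lemma12_twoTorus)
open Literature.MathematicalPhysics.QuantumFieldTheory.Balaban1983to89.B13NodeTorusFamily
  (last_pos_of_mem_box lemma3Printed_family)
open Literature.MathematicalPhysics.QuantumFieldTheory.Balaban1983to89.FlowStep (Box)

variable {L : ℕ} [NeZero L]
variable {N' : (k : ℕ) → (Fin (k + 1) → ℝ) → ℕ} [∀ k v, NeZero (N' k v)]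

/-! ## §1. Lemmas 1–2 for every member from per-member located inputs, constants uniform -/

/-- **LEMMA 1 ∧ LEMMA 2 FOR EVERY MEMBER OF A HISTORY-INDEXED FAMILY OF TWO-SCALE TORUS STEPS, FROM PER-MEMBER LOCATED INPUTS AT UNIFORM
CONSTANTS** — `B13NodeTorusTermwise.lemma12_twoTorus` applied member by member: the objects (index data of (1.33), terms, distances, local pieces,
coordinate reading, cubic terms) are indexed by `(k, v)`, every hypothesis is asked on the box `v ∈ ]0, γ₀]^{k+1}` only, Lemma 2's coupling is
`g_k = v (Fin.last k)` (nonzero on the box), and `c, K, K′, θ, R, K₂, m₂`, the choice of C₁, C₂, q and the thresholds are ONE for the whole run.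
[cite: Balaban1988RG2Cluster, Lemma 1 p.9, Lemma 2 p.11, (1.34) p.9, (1.38)–(1.39) p.10; Balaban1987RG1, Thm 1 p.259] -/
theorem lemma12_family (c : B13.Consts) (hL2 : 2 ≤ L) {γ₀ : ℝ}
    (Wt : (k : ℕ) → (v : Fin (k + 1) → ℝ) → TwoTorusStep 4 L (N' k v)) (hN12 : ∀ k v, 12 ≤ L * N' k v)
    -- (1) LEMMA 1: index data of (1.33), per member
    (S0 : (k : ℕ) → (v : Fin (k + 1) → ℝ) → TDom 4 (L * N' k v) → Finset (TPt 4 (L * N' k v)))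
    (F : (k : ℕ) → (v : Fin (k + 1) → ℝ) → TDom 4 (L * N' k v) → TPt 4 (L * N' k v) → Finset (TPt 4 (L * N' k v)))
    (Sq : (k : ℕ) → (v : Fin (k + 1) → ℝ) → TDom 4 (L * N' k v) → TPt 4 (L * N' k v) → (j : ℕ) →
      Finset (TPt 4 (L ^ (k - j) * (L * N' k v))))
    (SX : (k : ℕ) → (v : Fin (k + 1) → ℝ) → TDom 4 (L * N' k v) → TPt 4 (L * N' k v) → (j : ℕ) →
      TPt 4 (L ^ (k - j) * (L * N' k v)) → Finset (TDom 4 (L ^ (k - j) * (L * N' k v))))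
    (T : (k : ℕ) → (v : Fin (k + 1) → ℝ) → TDom 4 (L * N' k v) → TPt 4 (L * N' k v) → Finset (TPt 4 (L * N' k v)) →
      (j : ℕ) → TPt 4 (L ^ (k - j) * (L * N' k v)) → TDom 4 (L ^ (k - j) * (L * N' k v)) → (Wt k v).Φ → ℂ)
    (Sc : (k : ℕ) → (v : Fin (k + 1) → ℝ) → TDom 4 (L * N' k v) → Finset (TPt 4 (L * N' k v)))
    (Sq' : (k : ℕ) → (v : Fin (k + 1) → ℝ) → TDom 4 (L * N' k v) → TPt 4 (L * N' k v) → (j : ℕ) →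
      Finset (TPt 4 (L ^ (k - j) * (L * N' k v))))
    (SX' : (k : ℕ) → (v : Fin (k + 1) → ℝ) → TDom 4 (L * N' k v) → TPt 4 (L * N' k v) → (j : ℕ) →
      TPt 4 (L ^ (k - j) * (L * N' k v)) → Finset (TDom 4 (L ^ (k - j) * (L * N' k v))))
    (T' : (k : ℕ) → (v : Fin (k + 1) → ℝ) → TDom 4 (L * N' k v) → TPt 4 (L * N' k v) → (j : ℕ) →
      TPt 4 (L ^ (k - j) * (L * N' k v)) → TDom 4 (L ^ (k - j) * (L * N' k v)) → (Wt k v).Φ → ℂ)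
    (dist : (k : ℕ) → (v : Fin (k + 1) → ℝ) → TDom 4 (L * N' k v) → TPt 4 (L * N' k v) → (j : ℕ) →
      TPt 4 (L ^ (k - j) * (L * N' k v)) → ℝ)
    {K K' : ℝ}
    (h133 : ∀ k v, v ∈ Box γ₀ k → ∀ Y, (Wt k v).Vp Y =
      (∑ a ∈ S0 k v Y, ∑ X ∈ (F k v Y a).powerset, ∑ j ∈ Finset.range (k + 1), ∑ q ∈ Sq k v Y a j,
        ∑ x ∈ SX k v Y a j q, T k v Y a X j q x) +
      (∑ a ∈ Sc k v Y, ∑ j ∈ Finset.range (k + 1), ∑ q ∈ Sq' k v Y a j, ∑ x ∈ SX' k v Y a j q, T' k v Y a j q x))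
    (hS0Y : ∀ k v, v ∈ Box γ₀ k → ∀ Y, ∀ a ∈ S0 k v Y,
      (pbox (fun i => natLift a i - (5 : ℕ)) (fun i => natLift a i + 1 + (5 : ℕ))).image (proj (L * N' k v)) ⊆ Y.1)
    (hFsub : ∀ k v, v ∈ Box γ₀ k → ∀ Y a, F k v Y a ⊆
      (pbox (fun i => natLift a i - (5 : ℕ)) (fun i => natLift a i + 1 + (5 : ℕ))).image (proj (L * N' k v)) \
        (pbox (fun i => natLift a i - (4 : ℕ)) (fun i => natLift a i + 1 + (4 : ℕ))).image (proj (L * N' k v)))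
    (hSq : ∀ k v, v ∈ Box γ₀ k → ∀ Y, ∀ a ∈ S0 k v Y, ∀ j,
      Sq k v Y a j ⊆ (Finset.univ : Finset (TPt 4 (L ^ (k - j) * (L * N' k v)))).filter
        (fun q => tcoarse (L ^ (k - j)) (L * N' k v) q ∈
          (pbox (fun i => natLift a i - (2 : ℕ)) (fun i => natLift a i + 1 + (2 : ℕ))).image (proj (L * N' k v))))
    (hScY : ∀ k v, v ∈ Box γ₀ k → ∀ Y, Sc k v Y ⊆ Y.1)
    (hdist0 : ∀ k v, v ∈ Box γ₀ k → ∀ Y a j q, 0 ≤ c.δ₀ * dist k v Y a j q)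
    (hdist : ∀ k v, v ∈ Box γ₀ k → ∀ Y a j (n : ℕ) q,
      q ∉ (pbox (fun i => ((L ^ (k - j) : ℕ) : ℤ) * natLift a i - (n + 1 : ℕ))
        (fun i => ((L ^ (k - j) : ℕ) : ℤ) * natLift a i + 2 * ((L ^ (k - j) : ℕ) : ℤ) - 1 + (n + 1 : ℕ))).image
          (proj (L ^ (k - j) * (L * N' k v))) → c.δ₀ * c.M * ((n : ℝ) + 1) ≤ c.δ₀ * dist k v Y a j q)
    (hSX : ∀ k v, v ∈ Box γ₀ k → ∀ Y a j q, SX k v Y a j q ⊆ (tcubeSys 4 (L ^ (k - j) * (L * N' k v))).above q)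
    (hSX' : ∀ k v, v ∈ Box γ₀ k → ∀ Y a j q, SX' k v Y a j q ⊆ (tcubeSys 4 (L ^ (k - j) * (L * N' k v))).above q)
    (hX0 : ∀ k v, v ∈ Box γ₀ k → ∀ Y, ∀ a ∈ Sc k v Y, ∀ j ∈ Finset.range (k + 1), ∀ q ∈ Sq' k v Y a j,
      ∀ x ∈ SX' k v Y a j q, x.1.image (tcoarse (L ^ (k - j)) (L * N' k v)) ⊆ Y.1)
    -- (1) LEMMA 1: analyticity of the terms, closure of `Analytic`, per member
    (hAdd : ∀ k v, v ∈ Box γ₀ k → ∀ (σ : Set (Wt k v).Φ) (f₁ f₂ : (Wt k v).Φ → ℂ),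
      (Wt k v).Analytic f₁ σ → (Wt k v).Analytic f₂ σ → (Wt k v).Analytic (f₁ + f₂) σ)
    (hZero : ∀ k v, v ∈ Box γ₀ k → ∀ σ : Set (Wt k v).Φ, (Wt k v).Analytic 0 σ)
    (hAnT : ∀ k v, v ∈ Box γ₀ k → ∀ Y, ∀ a ∈ S0 k v Y, ∀ X ∈ (F k v Y a).powerset, ∀ j ∈ Finset.range (k + 1),
      ∀ q ∈ Sq k v Y a j, ∀ x ∈ SX k v Y a j q, (Wt k v).Analytic (T k v Y a X j q x) ((Wt k v).sp1 Y))
    (hAnT' : ∀ k v, v ∈ Box γ₀ k → ∀ Y, ∀ a ∈ Sc k v Y, ∀ j ∈ Finset.range (k + 1), ∀ q ∈ Sq' k v Y a j,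
      ∀ x ∈ SX' k v Y a j q, (Wt k v).Analytic (T' k v Y a j q x) ((Wt k v).sp1 Y))
    -- (1) LEMMA 1: thresholds and restrictions — ONE set for the run
    (hK : 0 ≤ K) (hK' : 0 ≤ K') (hκ : 0 ≤ c.κ) (hδ1 : c.δ < 1) (hδκ : 1 ≤ c.δ * c.κ)
    (hκ126 : kappa₀ 64 8 ≤ c.κ) (hκ126' : kappa₀ 64 8 ≤ c.δ * c.κ)
    (hκ₁ : 1 + 2 * Real.log (8 * 12 ^ 3) ≤ c.κ₁) (hκ₁' : 2 + 16 * Real.log 128 ≤ c.κ₁)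
    (hδ₀M : 10 * Real.exp (-1) ≤ c.δ₀ * c.M) (hδ₀M5 : 2 * Real.log 5 ≤ c.δ₀ * c.M)
    (hR8 : (1 - c.δ) * c.κ ≤ (1 / 4) * (c.κ₁ - 1)) (hR9 : (1 - 2 * c.δ) * c.κ ≤ (1 / 16) * c.κ₁)
    -- (1) LEMMA 1: per-term (1.24), (1.30) per member at the UNIFORM prefactors K, K′; ONE choice of C₁, C₂, q with headroom (1 − θ)
    (h124 : ∀ k v, v ∈ Box γ₀ k → ∀ Y φ, φ ∈ (Wt k v).sp1 Y → ∀ a ∈ S0 k v Y, ∀ X ∈ (F k v Y a).powerset,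
      ∀ j ∈ Finset.range (k + 1), ∀ q ∈ Sq k v Y a j, ∀ x ∈ SX k v Y a j q,
        ‖T k v Y a X j q x φ‖ ≤ K * ((L : ℝ) ^ j * ((L : ℝ) ^ k)⁻¹) ^ 5 *
          Real.exp (-(c.κ₁ - 1) *
            (((Y.1 \ (pbox (fun i => natLift a i - (5 : ℕ)) (fun i => natLift a i + 1 + (5 : ℕ))).image
              (proj (L * N' k v))).card : ℝ) + X.card)) *
          Real.exp (-(c.κ * torusTreeLen x.1)))
    (h130 : ∀ k v, v ∈ Box γ₀ k → ∀ Y φ, φ ∈ (Wt k v).sp1 Y → ∀ a ∈ Sc k v Y, ∀ j ∈ Finset.range (k + 1),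
      ∀ q ∈ Sq' k v Y a j, ∀ x ∈ SX' k v Y a j q,
        ‖T' k v Y a j q x φ‖ ≤ K' * Real.exp (-(1 / 2) * (c.δ₀ * c.M) * ((L : ℝ) ^ j * ((L : ℝ) ^ k)⁻¹)⁻¹
            - (1 / 2) * c.δ₀ * dist k v Y a j q) *
          Real.exp (-(c.κ₁ - 1) * ((Y.1 \ x.1.image (tcoarse (L ^ (k - j)) (L * N' k v))).card : ℝ)) *
          Real.exp (-(c.κ * torusTreeLen x.1)))
    {θ : ℝ} (hθ0 : 0 ≤ θ) (hθ1 : θ < 1)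
    (hC : K * K₀ 64 8 * (2 * (6 * (L : ℝ)) ^ 4) * Real.exp 1 * Real.exp ((1 / 8) * c.κ₁ * (12 ^ 4 - 1)) +
        2 * (64 * K') * K₀ 64 8 * 1344 ≤
      (1 - θ) * (c.E₀ * c.ε₁ * c.C₁ * c.M ^ c.q * Real.exp (c.C₂ * c.κ₁)))
    -- (2) LEMMA 2: V″_k = V′_k + the local pieces G of P^{(k)}, per member, (1.36)-small at the UNIFORM prefactor θ
    (Gl : (k : ℕ) → (v : Fin (k + 1) → ℝ) → TDom 4 (L * N' k v) → (Wt k v).Φ → ℂ)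
    (hVpp : ∀ k v, v ∈ Box γ₀ k → ∀ Y, (Wt k v).Vpp Y = fun φ => (Wt k v).Vp Y φ + Gl k v Y φ)
    (hGlAn : ∀ k v, v ∈ Box γ₀ k → ∀ Y, (Wt k v).Analytic (Gl k v Y) ((Wt k v).sp1 Y))
    (hGl : ∀ k v, v ∈ Box γ₀ k → ∀ Y φ, φ ∈ (Wt k v).sp1 Y →
      ‖Gl k v Y φ‖ ≤ θ * (c.E₀ * c.ε₁ * c.C₁ * c.M ^ c.q * Real.exp (c.C₂ * c.κ₁)) *
        Real.exp (-((1 - 2 * c.δ) * c.κ * (tsys 4 (L * N' k v)).dj Y)))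
    -- (2) LEMMA 2: the located per-cube data, per member; coupling g_k := v (Fin.last k); R, K₂, m₂, floor UNIFORM
    (E : (k : ℕ) → (Fin (k + 1) → ℝ) → Type*) [∀ k v, NormedAddCommGroup (E k v)] [∀ k v, NormedSpace ℂ (E k v)]
    (rd : (k : ℕ) → (v : Fin (k + 1) → ℝ) → TDom 4 (L * N' k v) → (Wt k v).Φ → E k v)
    (e : (k : ℕ) → (v : Fin (k + 1) → ℝ) → TDom 4 (L * N' k v) → (Wt k v).Bond → E k v)
    (he : ∀ k v, v ∈ Box γ₀ k → ∀ Y b, ‖e k v Y b‖ ≤ 1)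
    (hrd : ∀ k v, v ∈ Box γ₀ k → ∀ Y φ, rd k v Y φ = haveI := (Wt k v).finBond; ∑ b, (Wt k v).Bv φ b • e k v Y b)
    (ι₂ : (k : ℕ) → (Fin (k + 1) → ℝ) → Type*)
    (s : (k : ℕ) → (v : Fin (k + 1) → ℝ) → TDom 4 (L * N' k v) → Finset (ι₂ k v))
    (Wf : (k : ℕ) → (v : Fin (k + 1) → ℝ) → TDom 4 (L * N' k v) → ι₂ k v → (Wt k v).Φ → E k v → ℂ)
    {R K₂ : ℝ} {m₂ : ℕ} (hK₂ : 0 ≤ K₂) (hR : 0 < R) (h3 : 3 * c.ε₁ ≤ R)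
    (hW : ∀ k v, v ∈ Box γ₀ k → ∀ Y, ∀ i ∈ s k v Y, ∀ φ ∈ (Wt k v).sp1 Y, AnalyticOnNhd ℂ (Wf k v Y i φ) (ball 0 R))
    (hKW : ∀ k v, v ∈ Box γ₀ k → ∀ Y, ∀ i ∈ s k v Y, ∀ φ ∈ (Wt k v).sp1 Y, ∀ z ∈ ball (0 : E k v) R,
      ‖Wf k v Y i φ z‖ ≤ K₂ * Real.exp (-(c.κ₁ - 1) * ((Y.1.card : ℝ) - 1)) * ‖z‖ ^ 3)
    (hcard : ∀ k v, v ∈ Box γ₀ k → ∀ Y, (s k v Y).card ≤ m₂ * Y.1.card)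
    (hV : ∀ k v, v ∈ Box γ₀ k → ∀ Y, (Wt k v).V Y = fun φ =>
      (∑ i ∈ s k v Y, scaled ((v (Fin.last k) : ℝ) : ℂ) (Wf k v Y i φ) (rd k v Y φ)) + (Wt k v).Vpp Y φ)
    (hQ : ∀ k v, v ∈ Box γ₀ k → ∀ Y φ (b b' : (Wt k v).Bond), φ ∈ (Wt k v).sp1 Y →
      (Wt k v).Q Y φ b b' =
        2 * ∑ i ∈ s k v Y, Qop (scaled ((v (Fin.last k) : ℝ) : ℂ) (Wf k v Y i φ)) (rd k v Y φ) (e k v Y b) (e k v Y b'))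
    (hsp : ∀ k v, v ∈ Box γ₀ k → ∀ Y φ, φ ∈ (Wt k v).sp1 Y → ‖((v (Fin.last k) : ℝ) : ℂ)‖ * ‖rd k v Y φ‖ < c.ε₁)
    (hvolk : ∀ k v, v ∈ Box γ₀ k → ∀ Y, (Wt k v).volk Y = Y.1.card)
    (hfloor : 27 * m₂ * K₂ * Real.exp (c.κ₁ - 1) ≤ c.C₃ * c.M ^ 4 * Real.exp (c.C₂ * c.κ₁))
    (hAnP : ∀ k v, v ∈ Box γ₀ k → ∀ Y, ∀ i ∈ s k v Y,
      (Wt k v).Analytic (fun φ => scaled ((v (Fin.last k) : ℝ) : ℂ) (Wf k v Y i φ) (rd k v Y φ)) ((Wt k v).sp1 Y))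
    (hG : ∀ k v, v ∈ Box γ₀ k → ∀ Y, (Wt k v).GaugeInv ((Wt k v).V Y) ∧
      (Wt k v).GaugeInv ((Wt k v).toStepData.quadForm Y) ∧ (Wt k v).GaugeInv ((Wt k v).Vpp Y)) :
    ∀ k v, v ∈ Box γ₀ k →
      B13.Lemma1Printed (Wt k v).toStepData c ∧ B13.Lemma2Printed (Wt k v).toStepData c := by
  intro k v hv
  have hg : ((v (Fin.last k) : ℝ) : ℂ) ≠ 0 := Complex.ofReal_ne_zero.2 (last_pos_of_mem_box hv).ne'
  exact lemma12_twoTorus (Wt k v) c k (hN12 k v) hL2 (S0 k v) (F k v) (Sq k v) (SX k v) (T k v) (Sc k v) (Sq' k v)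
    (SX' k v) (T' k v) (dist k v) (h133 k v hv) (hS0Y k v hv) (hFsub k v hv) (hSq k v hv) (hScY k v hv)
    (hdist0 k v hv) (hdist k v hv) (hSX k v hv) (hSX' k v hv) (hX0 k v hv) (hAdd k v hv) (hZero k v hv)
    (hAnT k v hv) (hAnT' k v hv) hK hK' hκ hδ1 hδκ hκ126 hκ126' hκ₁ hκ₁' hδ₀M hδ₀M5 hR8 hR9 (h124 k v hv)
    (h130 k v hv) hθ0 hθ1 hC (Gl k v) (hVpp k v hv) (hGlAn k v hv) (hGl k v hv) (rd k v) (e k v) (he k v hv)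
    (hrd k v hv) (s k v) (Wf k v) hg hK₂ hR h3 (hW k v hv) (hKW k v hv) (hcard k v hv) (hV k v hv) (hQ k v hv)
    (hsp k v hv) (hvolk k v hv) hfloor (hAnP k v hv) (hG k v hv)

/-! ## §2. The (R1) family triple from located inputs only -/

open Classical in
/-- **THE HISTORY-INDEXED B13 FAMILY FROM LOCATED INPUTS ONLY — NO LEAF CONJUNCT AS HYPOTHESIS.**  §1's per-member located inputs of Lemmas 1–2 at
uniform constants, plus per member the Lemma-3 inputs at LEVEL T (term map `T₃ k v`, termwise domination (2.9)/(2.14), (2.26) per term at the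
natural rate `γ₂ε₁²/g_k²`) and ONE bundle of the printed restrictions at the box-minimal rate `γ₂ε₁²/γ₀²` (`c.L = L ≥ 8`, `0 ≤ γ₂`) give
`Lemma1Printed ∧ Lemma2Printed ∧ Lemma3Printed` for `(Wt k v).toStepData` at EVERY `(k, v)`, `v ∈ ]0, γ₀]^{k+1}`, at ONE constants record `c`.
[cite: Balaban1988RG2Cluster, Lemma 1 p.9, Lemma 2 p.11, Lemma 3 p.20, (2.26) p.17, p.18] -/
theorem b13Family_located (c : B13.Consts) (hL8 : 8 ≤ c.L) (hLc : c.L = L) (hγ₂ : 0 ≤ c.γ₂) {γ₀ : ℝ}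
    (Wt : (k : ℕ) → (v : Fin (k + 1) → ℝ) → TwoTorusStep 4 L (N' k v)) (hN12 : ∀ k v, 12 ≤ L * N' k v)
    -- (1) LEMMA 1: index data of (1.33), per member
    (S0 : (k : ℕ) → (v : Fin (k + 1) → ℝ) → TDom 4 (L * N' k v) → Finset (TPt 4 (L * N' k v)))
    (F : (k : ℕ) → (v : Fin (k + 1) → ℝ) → TDom 4 (L * N' k v) → TPt 4 (L * N' k v) → Finset (TPt 4 (L * N' k v)))
    (Sq : (k : ℕ) → (v : Fin (k + 1) → ℝ) → TDom 4 (L * N' k v) → TPt 4 (L * N' k v) → (j : ℕ) →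
      Finset (TPt 4 (L ^ (k - j) * (L * N' k v))))
    (SX : (k : ℕ) → (v : Fin (k + 1) → ℝ) → TDom 4 (L * N' k v) → TPt 4 (L * N' k v) → (j : ℕ) →
      TPt 4 (L ^ (k - j) * (L * N' k v)) → Finset (TDom 4 (L ^ (k - j) * (L * N' k v))))
    (T : (k : ℕ) → (v : Fin (k + 1) → ℝ) → TDom 4 (L * N' k v) → TPt 4 (L * N' k v) → Finset (TPt 4 (L * N' k v)) →
      (j : ℕ) → TPt 4 (L ^ (k - j) * (L * N' k v)) → TDom 4 (L ^ (k - j) * (L * N' k v)) → (Wt k v).Φ → ℂ)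
    (Sc : (k : ℕ) → (v : Fin (k + 1) → ℝ) → TDom 4 (L * N' k v) → Finset (TPt 4 (L * N' k v)))
    (Sq' : (k : ℕ) → (v : Fin (k + 1) → ℝ) → TDom 4 (L * N' k v) → TPt 4 (L * N' k v) → (j : ℕ) →
      Finset (TPt 4 (L ^ (k - j) * (L * N' k v))))
    (SX' : (k : ℕ) → (v : Fin (k + 1) → ℝ) → TDom 4 (L * N' k v) → TPt 4 (L * N' k v) → (j : ℕ) →
      TPt 4 (L ^ (k - j) * (L * N' k v)) → Finset (TDom 4 (L ^ (k - j) * (L * N' k v))))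
    (T' : (k : ℕ) → (v : Fin (k + 1) → ℝ) → TDom 4 (L * N' k v) → TPt 4 (L * N' k v) → (j : ℕ) →
      TPt 4 (L ^ (k - j) * (L * N' k v)) → TDom 4 (L ^ (k - j) * (L * N' k v)) → (Wt k v).Φ → ℂ)
    (dist : (k : ℕ) → (v : Fin (k + 1) → ℝ) → TDom 4 (L * N' k v) → TPt 4 (L * N' k v) → (j : ℕ) →
      TPt 4 (L ^ (k - j) * (L * N' k v)) → ℝ)
    {K K' : ℝ}
    (h133 : ∀ k v, v ∈ Box γ₀ k → ∀ Y, (Wt k v).Vp Y =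
      (∑ a ∈ S0 k v Y, ∑ X ∈ (F k v Y a).powerset, ∑ j ∈ Finset.range (k + 1), ∑ q ∈ Sq k v Y a j,
        ∑ x ∈ SX k v Y a j q, T k v Y a X j q x) +
      (∑ a ∈ Sc k v Y, ∑ j ∈ Finset.range (k + 1), ∑ q ∈ Sq' k v Y a j, ∑ x ∈ SX' k v Y a j q, T' k v Y a j q x))
    (hS0Y : ∀ k v, v ∈ Box γ₀ k → ∀ Y, ∀ a ∈ S0 k v Y,
      (pbox (fun i => natLift a i - (5 : ℕ)) (fun i => natLift a i + 1 + (5 : ℕ))).image (proj (L * N' k v)) ⊆ Y.1)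
    (hFsub : ∀ k v, v ∈ Box γ₀ k → ∀ Y a, F k v Y a ⊆
      (pbox (fun i => natLift a i - (5 : ℕ)) (fun i => natLift a i + 1 + (5 : ℕ))).image (proj (L * N' k v)) \
        (pbox (fun i => natLift a i - (4 : ℕ)) (fun i => natLift a i + 1 + (4 : ℕ))).image (proj (L * N' k v)))
    (hSq : ∀ k v, v ∈ Box γ₀ k → ∀ Y, ∀ a ∈ S0 k v Y, ∀ j,
      Sq k v Y a j ⊆ (Finset.univ : Finset (TPt 4 (L ^ (k - j) * (L * N' k v)))).filter
        (fun q => tcoarse (L ^ (k - j)) (L * N' k v) q ∈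
          (pbox (fun i => natLift a i - (2 : ℕ)) (fun i => natLift a i + 1 + (2 : ℕ))).image (proj (L * N' k v))))
    (hScY : ∀ k v, v ∈ Box γ₀ k → ∀ Y, Sc k v Y ⊆ Y.1)
    (hdist0 : ∀ k v, v ∈ Box γ₀ k → ∀ Y a j q, 0 ≤ c.δ₀ * dist k v Y a j q)
    (hdist : ∀ k v, v ∈ Box γ₀ k → ∀ Y a j (n : ℕ) q,
      q ∉ (pbox (fun i => ((L ^ (k - j) : ℕ) : ℤ) * natLift a i - (n + 1 : ℕ))
        (fun i => ((L ^ (k - j) : ℕ) : ℤ) * natLift a i + 2 * ((L ^ (k - j) : ℕ) : ℤ) - 1 + (n + 1 : ℕ))).image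
          (proj (L ^ (k - j) * (L * N' k v))) → c.δ₀ * c.M * ((n : ℝ) + 1) ≤ c.δ₀ * dist k v Y a j q)
    (hSX : ∀ k v, v ∈ Box γ₀ k → ∀ Y a j q, SX k v Y a j q ⊆ (tcubeSys 4 (L ^ (k - j) * (L * N' k v))).above q)
    (hSX' : ∀ k v, v ∈ Box γ₀ k → ∀ Y a j q, SX' k v Y a j q ⊆ (tcubeSys 4 (L ^ (k - j) * (L * N' k v))).above q)
    (hX0 : ∀ k v, v ∈ Box γ₀ k → ∀ Y, ∀ a ∈ Sc k v Y, ∀ j ∈ Finset.range (k + 1), ∀ q ∈ Sq' k v Y a j,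
      ∀ x ∈ SX' k v Y a j q, x.1.image (tcoarse (L ^ (k - j)) (L * N' k v)) ⊆ Y.1)
    -- (1) LEMMA 1: analyticity of the terms, closure of `Analytic`, per member
    (hAdd : ∀ k v, v ∈ Box γ₀ k → ∀ (σ : Set (Wt k v).Φ) (f₁ f₂ : (Wt k v).Φ → ℂ),
      (Wt k v).Analytic f₁ σ → (Wt k v).Analytic f₂ σ → (Wt k v).Analytic (f₁ + f₂) σ)
    (hZero : ∀ k v, v ∈ Box γ₀ k → ∀ σ : Set (Wt k v).Φ, (Wt k v).Analytic 0 σ)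
    (hAnT : ∀ k v, v ∈ Box γ₀ k → ∀ Y, ∀ a ∈ S0 k v Y, ∀ X ∈ (F k v Y a).powerset, ∀ j ∈ Finset.range (k + 1),
      ∀ q ∈ Sq k v Y a j, ∀ x ∈ SX k v Y a j q, (Wt k v).Analytic (T k v Y a X j q x) ((Wt k v).sp1 Y))
    (hAnT' : ∀ k v, v ∈ Box γ₀ k → ∀ Y, ∀ a ∈ Sc k v Y, ∀ j ∈ Finset.range (k + 1), ∀ q ∈ Sq' k v Y a j,
      ∀ x ∈ SX' k v Y a j q, (Wt k v).Analytic (T' k v Y a j q x) ((Wt k v).sp1 Y))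
    -- (1) LEMMA 1: thresholds and restrictions — ONE set for the run
    (hK : 0 ≤ K) (hK' : 0 ≤ K') (hκ : 0 ≤ c.κ) (hδ1 : c.δ < 1) (hδκ : 1 ≤ c.δ * c.κ)
    (hκ126 : kappa₀ 64 8 ≤ c.κ) (hκ126' : kappa₀ 64 8 ≤ c.δ * c.κ)
    (hκ₁ : 1 + 2 * Real.log (8 * 12 ^ 3) ≤ c.κ₁) (hκ₁' : 2 + 16 * Real.log 128 ≤ c.κ₁)
    (hδ₀M : 10 * Real.exp (-1) ≤ c.δ₀ * c.M) (hδ₀M5 : 2 * Real.log 5 ≤ c.δ₀ * c.M)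
    (hR8 : (1 - c.δ) * c.κ ≤ (1 / 4) * (c.κ₁ - 1)) (hR9 : (1 - 2 * c.δ) * c.κ ≤ (1 / 16) * c.κ₁)
    -- (1) LEMMA 1: per-term (1.24), (1.30) per member at the UNIFORM prefactors K, K′; ONE choice of C₁, C₂, q with headroom (1 − θ)
    (h124 : ∀ k v, v ∈ Box γ₀ k → ∀ Y φ, φ ∈ (Wt k v).sp1 Y → ∀ a ∈ S0 k v Y, ∀ X ∈ (F k v Y a).powerset,
      ∀ j ∈ Finset.range (k + 1), ∀ q ∈ Sq k v Y a j, ∀ x ∈ SX k v Y a j q,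
        ‖T k v Y a X j q x φ‖ ≤ K * ((L : ℝ) ^ j * ((L : ℝ) ^ k)⁻¹) ^ 5 *
          Real.exp (-(c.κ₁ - 1) *
            (((Y.1 \ (pbox (fun i => natLift a i - (5 : ℕ)) (fun i => natLift a i + 1 + (5 : ℕ))).image
              (proj (L * N' k v))).card : ℝ) + X.card)) *
          Real.exp (-(c.κ * torusTreeLen x.1)))
    (h130 : ∀ k v, v ∈ Box γ₀ k → ∀ Y φ, φ ∈ (Wt k v).sp1 Y → ∀ a ∈ Sc k v Y, ∀ j ∈ Finset.range (k + 1),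
      ∀ q ∈ Sq' k v Y a j, ∀ x ∈ SX' k v Y a j q,
        ‖T' k v Y a j q x φ‖ ≤ K' * Real.exp (-(1 / 2) * (c.δ₀ * c.M) * ((L : ℝ) ^ j * ((L : ℝ) ^ k)⁻¹)⁻¹
            - (1 / 2) * c.δ₀ * dist k v Y a j q) *
          Real.exp (-(c.κ₁ - 1) * ((Y.1 \ x.1.image (tcoarse (L ^ (k - j)) (L * N' k v))).card : ℝ)) *
          Real.exp (-(c.κ * torusTreeLen x.1)))
    {θ : ℝ} (hθ0 : 0 ≤ θ) (hθ1 : θ < 1)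
    (hC : K * K₀ 64 8 * (2 * (6 * (L : ℝ)) ^ 4) * Real.exp 1 * Real.exp ((1 / 8) * c.κ₁ * (12 ^ 4 - 1)) +
        2 * (64 * K') * K₀ 64 8 * 1344 ≤
      (1 - θ) * (c.E₀ * c.ε₁ * c.C₁ * c.M ^ c.q * Real.exp (c.C₂ * c.κ₁)))
    -- (2) LEMMA 2: V″_k = V′_k + the local pieces G of P^{(k)}, per member, (1.36)-small at the UNIFORM prefactor θ
    (Gl : (k : ℕ) → (v : Fin (k + 1) → ℝ) → TDom 4 (L * N' k v) → (Wt k v).Φ → ℂ)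
    (hVpp : ∀ k v, v ∈ Box γ₀ k → ∀ Y, (Wt k v).Vpp Y = fun φ => (Wt k v).Vp Y φ + Gl k v Y φ)
    (hGlAn : ∀ k v, v ∈ Box γ₀ k → ∀ Y, (Wt k v).Analytic (Gl k v Y) ((Wt k v).sp1 Y))
    (hGl : ∀ k v, v ∈ Box γ₀ k → ∀ Y φ, φ ∈ (Wt k v).sp1 Y →
      ‖Gl k v Y φ‖ ≤ θ * (c.E₀ * c.ε₁ * c.C₁ * c.M ^ c.q * Real.exp (c.C₂ * c.κ₁)) *
        Real.exp (-((1 - 2 * c.δ) * c.κ * (tsys 4 (L * N' k v)).dj Y)))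
    -- (2) LEMMA 2: the located per-cube data, per member; coupling g_k := v (Fin.last k); R, K₂, m₂, floor UNIFORM
    (E : (k : ℕ) → (Fin (k + 1) → ℝ) → Type*) [∀ k v, NormedAddCommGroup (E k v)] [∀ k v, NormedSpace ℂ (E k v)]
    (rd : (k : ℕ) → (v : Fin (k + 1) → ℝ) → TDom 4 (L * N' k v) → (Wt k v).Φ → E k v)
    (e : (k : ℕ) → (v : Fin (k + 1) → ℝ) → TDom 4 (L * N' k v) → (Wt k v).Bond → E k v)
    (he : ∀ k v, v ∈ Box γ₀ k → ∀ Y b, ‖e k v Y b‖ ≤ 1)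
    (hrd : ∀ k v, v ∈ Box γ₀ k → ∀ Y φ, rd k v Y φ = haveI := (Wt k v).finBond; ∑ b, (Wt k v).Bv φ b • e k v Y b)
    (ι₂ : (k : ℕ) → (Fin (k + 1) → ℝ) → Type*)
    (s : (k : ℕ) → (v : Fin (k + 1) → ℝ) → TDom 4 (L * N' k v) → Finset (ι₂ k v))
    (Wf : (k : ℕ) → (v : Fin (k + 1) → ℝ) → TDom 4 (L * N' k v) → ι₂ k v → (Wt k v).Φ → E k v → ℂ)
    {R K₂ : ℝ} {m₂ : ℕ} (hK₂ : 0 ≤ K₂) (hR : 0 < R) (h3 : 3 * c.ε₁ ≤ R)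
    (hW : ∀ k v, v ∈ Box γ₀ k → ∀ Y, ∀ i ∈ s k v Y, ∀ φ ∈ (Wt k v).sp1 Y, AnalyticOnNhd ℂ (Wf k v Y i φ) (ball 0 R))
    (hKW : ∀ k v, v ∈ Box γ₀ k → ∀ Y, ∀ i ∈ s k v Y, ∀ φ ∈ (Wt k v).sp1 Y, ∀ z ∈ ball (0 : E k v) R,
      ‖Wf k v Y i φ z‖ ≤ K₂ * Real.exp (-(c.κ₁ - 1) * ((Y.1.card : ℝ) - 1)) * ‖z‖ ^ 3)
    (hcard : ∀ k v, v ∈ Box γ₀ k → ∀ Y, (s k v Y).card ≤ m₂ * Y.1.card)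
    (hV : ∀ k v, v ∈ Box γ₀ k → ∀ Y, (Wt k v).V Y = fun φ =>
      (∑ i ∈ s k v Y, scaled ((v (Fin.last k) : ℝ) : ℂ) (Wf k v Y i φ) (rd k v Y φ)) + (Wt k v).Vpp Y φ)
    (hQ : ∀ k v, v ∈ Box γ₀ k → ∀ Y φ (b b' : (Wt k v).Bond), φ ∈ (Wt k v).sp1 Y →
      (Wt k v).Q Y φ b b' =
        2 * ∑ i ∈ s k v Y, Qop (scaled ((v (Fin.last k) : ℝ) : ℂ) (Wf k v Y i φ)) (rd k v Y φ) (e k v Y b) (e k v Y b'))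
    (hsp : ∀ k v, v ∈ Box γ₀ k → ∀ Y φ, φ ∈ (Wt k v).sp1 Y → ‖((v (Fin.last k) : ℝ) : ℂ)‖ * ‖rd k v Y φ‖ < c.ε₁)
    (hvolk : ∀ k v, v ∈ Box γ₀ k → ∀ Y, (Wt k v).volk Y = Y.1.card)
    (hfloor : 27 * m₂ * K₂ * Real.exp (c.κ₁ - 1) ≤ c.C₃ * c.M ^ 4 * Real.exp (c.C₂ * c.κ₁))
    (hAnP : ∀ k v, v ∈ Box γ₀ k → ∀ Y, ∀ i ∈ s k v Y,
      (Wt k v).Analytic (fun φ => scaled ((v (Fin.last k) : ℝ) : ℂ) (Wf k v Y i φ) (rd k v Y φ)) ((Wt k v).sp1 Y))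
    (hG : ∀ k v, v ∈ Box γ₀ k → ∀ Y, (Wt k v).GaugeInv ((Wt k v).V Y) ∧
      (Wt k v).GaugeInv ((Wt k v).toStepData.quadForm Y) ∧ (Wt k v).GaugeInv ((Wt k v).Vpp Y))
    -- (3) LEMMA 3 at LEVEL T, per member: the terms of H(Z), termwise domination, (2.26) per term at the NATURAL rate; ONE numerics bundle
    (M₃ : ℕ) [NeZero M₃]
    (T₃ : (k : ℕ) → (v : Fin (k + 1) → ℝ) → (Z : TDom 4 (N' k v)) →
      Finset (TDom 4 (L * N' k v)) × Finset (TBond 4 M₃ (L * N' k v)) → (Wt k v).Φ → ℂ)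
    {a₂ a₂' a₅ Aabs : ℝ}
    (hH : ∀ k v, v ∈ Box γ₀ k → TermDomination M₃ (Wt k v) (T₃ k v))
    (h226 : ∀ k v, v ∈ Box γ₀ k → Termwise226 c (c.γ₂ * c.ε₁ ^ 2 / (v (Fin.last k)) ^ 2) a₅ (Wt k v) (T₃ k v))
    (hN : Lemma3Numerics c M₃ ((c.L : ℝ) / 2) (c.γ₂ * c.ε₁ ^ 2 / γ₀ ^ 2) a₂ a₂' a₅ Aabs) :
    ∀ k v, v ∈ Box γ₀ k →
      B13.Lemma1Printed (Wt k v).toStepData c ∧ B13.Lemma2Printed (Wt k v).toStepData c ∧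
        B13.Lemma3Printed (Wt k v).toStepData c := by
  have hL2 : 2 ≤ L := by rw [← hLc]; exact le_trans (by norm_num) hL8
  intro k v hv
  have h12 := lemma12_family c hL2 Wt hN12 S0 F Sq SX T Sc Sq' SX' T' dist h133 hS0Y hFsub hSq hScY hdist0 hdist hSX hSX'
    hX0 hAdd hZero hAnT hAnT' hK hK' hκ hδ1 hδκ hκ126 hκ126' hκ₁ hκ₁' hδ₀M hδ₀M5 hR8 hR9 h124 h130 hθ0 hθ1 hC Gl hVpp
    hGlAn hGl E rd e he hrd ι₂ s Wf hK₂ hR h3 hW hKW hcard hV hQ hsp hvolk hfloor hAnP hG k v hv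
  exact ⟨h12.1, h12.2, lemma3Printed_family c hL8 hLc hγ₂ Wt M₃ T₃ hH h226 hN k v hv⟩

open Classical in
/-- **THE DAGWRITER'S `b13` FAMILY PREDICATE FROM LOCATED INPUTS**: for a step-data family `S13 : (k : ℕ) → (Fin (k + 1) → ℝ) → B13.StepData`
pinned on the box to the torus records (`hS : S13 k v = (Wt k v).toStepData`), the conclusion of `b13Family_located` reads
`∀ k v, v ∈ FlowStep.Box γ₀ k → Lemma1Printed (S13 k v) c ∧ Lemma2Printed (S13 k v) c ∧ Lemma3Printed (S13 k v) c` (word (R1), bus l.9758).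
[cite: Balaban1988RG2Cluster, Lemmas 1–3 pp.9, 11, 20] -/
theorem b13Family_located_stepData (c : B13.Consts) {γ₀ : ℝ} (S13 : (k : ℕ) → (Fin (k + 1) → ℝ) → B13.StepData)
    (Wt : (k : ℕ) → (v : Fin (k + 1) → ℝ) → TwoTorusStep 4 L (N' k v))
    (hS : ∀ k v, v ∈ Box γ₀ k → S13 k v = (Wt k v).toStepData)
    (hWt : ∀ k v, v ∈ Box γ₀ k →
      B13.Lemma1Printed (Wt k v).toStepData c ∧ B13.Lemma2Printed (Wt k v).toStepData c ∧
        B13.Lemma3Printed (Wt k v).toStepData c) :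
    ∀ k v, v ∈ Box γ₀ k →
      B13.Lemma1Printed (S13 k v) c ∧ B13.Lemma2Printed (S13 k v) c ∧ B13.Lemma3Printed (S13 k v) c := by
  intro k v hv
  rw [hS k v hv]
  exact hWt k v hv

end Literature.MathematicalPhysics.QuantumFieldTheory.Balaban1983to89.B13NodeTorusFamilyLocated

end
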